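import Summits.Ventures.HSemireg.WedgeHankelRecurrenceLinearComplexityCensus

/-!
# Venture HSemireg — THE LINEAR COMPLEXITIES PARTITION THE CLASSES: over a field with `s` elements the `s^{N+1}` sequences `q_0, …, q_N` split by their linear complexity `ℓ = 0, …, N + 1`,
# **`Σ_{ℓ ≤ N+1} #{q | L(q) = ℓ} = s^{N+1}`**, whence (N71) RUEPPEL'S IDENTITY **`1 + Σ_{ℓ=1}^{N+1} (s − 1)·s^{min(2ℓ−1, 2(N+1)−2ℓ)} = s^{N+1}`** — proved by counting, for `s` the cardinality of any
# finite field

HONEST FRAMING. Part of the Lean index of the computation cell `pub-hsemireg` (seat p10 gen 30, Sunday typer «UNIFORM-IN-n»).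
LINEAR ALGEBRA OF HANKEL (catalecticant) MATRICES and of polynomials over a field ONLY: no variety, no cohomology theory, no sheaf, no Ext group and no semiregularity map is constructed
here; nothing here says that HC / HC_CM / HC_AV holds; no Literature fact is declared or used.  Custodian versions as in `WedgeHankelSiegelIdeal` (1/3); as in N70/N71 the linear complexity is
the `IsLeast` (equivalently `sInf`) of the inline set `S^N(q) = {k | ∃ p ∈ Rec^N_k(q), p ≠ 0 ∧ deg p = k}`, no definition; the identity is stated for `s = Nat.card K` only (quoted: Rueppel
1986, Ch. 4 — the expected-linear-complexity bookkeeping starts from it).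

WHAT IS IN THE TREE / CHAINED.  N71 (`WedgeHankelRecurrenceLinearComplexityCensus`): `ncard_setOf_isLeast_lfsr` (Rueppel's count for `1 ≤ ℓ ≤ N + 1`), `ncard_setOf_isLeast_lfsr_zero`,
`isLeast_setOf_lfsr_le_succ`; N70 (`WedgeHankelRecurrenceLinearComplexity`): `succ_level_mem_setOf_lfsr` (`S^N(q)` is non-empty); N44 (№ 326) `seqOf`.  Mathlib: `Nat.sInf_mem`, `Nat.sInf_le`,
`IsLeast.csInf_eq`, `IsLeast.unique`, `Finset.card_eq_sum_card_fiberwise`, `Set.ncard_coe_finset`, `Finset.sum_range_succ'`, `Fintype.card_fun` / `Nat.card_eq_fintype_card`.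
THIS FILE (namespace `Summit.Ventures.HSemireg.Wedge.HankelOuter` continued; CHAINED on N71; 0 definitions):
* §636 `isLeast_sInf_setOf_lfsr` (`sInf S^N(q)` IS the linear complexity), `setOf_isLeast_lfsr_eq_setOf_sInf_eq`, **`sum_ncard_setOf_isLeast_lfsr`** (`Σ_{ℓ < N+2} #{v | L = ℓ} = s^{N+1}`),
  **`one_add_sum_rueppel_eq_pow`** (`1 + Σ_{ℓ=1}^{N+1} (s − 1)·s^{min(2ℓ−1, 2(N+1)−2ℓ)} = s^{N+1}` for `s = #K`).
Nothing Ext-side.  New names only.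
-/

open Module Polynomial
open scoped Matrix Polynomial

namespace Summit.Ventures.HSemireg.Wedge.HankelOuter

open Summit.Ventures.HSemireg.Wedge Summit.Ventures.HSemireg.Wedge.Hankel

variable (K : Type*) [Field K] {N : ℕ}

/-! ## §636. The partition by linear complexity and Rueppel's identity -/

/-- **`sInf S^N(q)` is the linear complexity**: `S^N(q)` is non-empty (`N + 1 ∈ S^N(q)`), so its infimum is its least element. -/
theorem isLeast_sInf_setOf_lfsr (q : ℕ → K) :
    IsLeast {k : ℕ | ∃ p ∈ recSpace K N q k, p ≠ 0 ∧ p.natDegree = k} (sInf {k : ℕ | ∃ p ∈ recSpace K N q k, p ≠ 0 ∧ p.natDegree = k}) :=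
  ⟨Nat.sInf_mem ⟨N + 1, succ_level_mem_setOf_lfsr K q⟩, fun _ hk => Nat.sInf_le hk⟩

/-- `{v | IsLeast S^N(v) ℓ} = {v | sInf S^N(v) = ℓ}`. -/
theorem setOf_isLeast_lfsr_eq_setOf_sInf_eq (l : ℕ) :
    {v : Fin (N + 1) → K | IsLeast {k : ℕ | ∃ p ∈ recSpace K N (seqOf K v) k, p ≠ 0 ∧ p.natDegree = k} l}
      = {v : Fin (N + 1) → K | sInf {k : ℕ | ∃ p ∈ recSpace K N (seqOf K v) k, p ≠ 0 ∧ p.natDegree = k} = l} := by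
  ext v
  exact ⟨fun h => h.csInf_eq, fun h => h ▸ isLeast_sInf_setOf_lfsr K (seqOf K v)⟩

/-- **THE LINEAR COMPLEXITIES PARTITION THE `s^{N+1}` CLASSES: `Σ_{ℓ ≤ N+1} #{v on [0, N] | L(v) = ℓ} = s^{N+1}`** (every class has exactly one linear complexity, and it is `≤ N + 1`). -/
theorem sum_ncard_setOf_isLeast_lfsr [Finite K] (N : ℕ) :
    ∑ l ∈ Finset.range (N + 2), {v : Fin (N + 1) → K | IsLeast {k : ℕ | ∃ p ∈ recSpace K N (seqOf K v) k, p ≠ 0 ∧ p.natDegree = k} l}.ncard = Nat.card K ^ (N + 1) := by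
  classical
  haveI := Fintype.ofFinite K
  let L : (Fin (N + 1) → K) → ℕ := fun v => sInf {k : ℕ | ∃ p ∈ recSpace K N (seqOf K v) k, p ≠ 0 ∧ p.natDegree = k}
  have hmaps : ((Finset.univ : Finset (Fin (N + 1) → K)) : Set (Fin (N + 1) → K)).MapsTo L (Finset.range (N + 2) : Finset ℕ) := fun v _ =>
    Finset.mem_coe.mpr (Finset.mem_range.mpr (Nat.lt_succ_of_le (isLeast_setOf_lfsr_le_succ K (isLeast_sInf_setOf_lfsr K (seqOf K v)))))
  have h := Finset.card_eq_sum_card_fiberwise hmaps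
  rw [Finset.card_univ, Fintype.card_fun, Fintype.card_fin, ← Nat.card_eq_fintype_card] at h
  rw [h]
  refine Finset.sum_congr rfl fun l _ => ?_
  rw [setOf_isLeast_lfsr_eq_setOf_sInf_eq, ← Set.ncard_coe_finset, Finset.coe_filter]
  exact congrArg Set.ncard (Set.ext fun v => by simp only [Set.mem_setOf_eq, Finset.mem_univ, true_and, L])

/-- **RUEPPEL'S IDENTITY, BY COUNTING: `1 + Σ_{ℓ=1}^{N+1} (s − 1)·s^{min(2ℓ − 1, 2(N + 1) − 2ℓ)} = s^{N+1}`** for `s = #K` the cardinality of a finite field (N71's census of each linear complexity summed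
over the partition). -/
theorem one_add_sum_rueppel_eq_pow [Finite K] (N : ℕ) :
    1 + ∑ l ∈ Finset.range (N + 1), (Nat.card K - 1) * Nat.card K ^ min (2 * (l + 1) - 1) (2 * (N + 1) - 2 * (l + 1)) = Nat.card K ^ (N + 1) := by
  rw [← sum_ncard_setOf_isLeast_lfsr K N, Finset.sum_range_succ' _ (N + 1), ncard_setOf_isLeast_lfsr_zero, add_comm]
  congr 1
  exact Finset.sum_congr rfl fun l hl => (ncard_setOf_isLeast_lfsr K (N := N) (l := l + 1) (by omega) (by have := Finset.mem_range.mp hl; omega)).symm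

end Summit.Ventures.HSemireg.Wedge.HankelOuter
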